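import Summits.QuantumFields.BalabanUV.Beta.GAN24.CombesThomas

/-!
# `BalabanUV.Beta.GAN24.StencilSlotVH` — binder row G-an2-4 / (CONV-C), AFTER the K-slot: the (V-H) PIECE of the wall's STENCIL slot
# `(hS, hSall)` is EXACTLY `j`-INDEPENDENT in the K-slot's units `(sfStep Lc, smStep d Lc)` — uniform locality with the one-step
# constants and ZERO drift (note `HOME/b2b-balaban-gan24-p1/S-SLOT.md` §2 (P-VH), §4 (U-S1), §5 target S1)

NOT IN PRINT; OUR PROOF ATTEMPT (row owner b2b-balaban-gan24-p1, gen 3).  HONEST FRAMING (cell contract, verbatim): «discharging `BetaPertH`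
makes Bałaban's UV stability UNCONDITIONAL — a real constructive-QFT result; it is NOT the continuum limit and NOT the Clay problem.»
HONEST DEPENDENCY (verbatim): «continuum YM on T⁴ ⇐ BetaPertH ∧ nine spine estimates (0/9 proved); BetaPertH ⇐ (D1) ∧ (D4) ∧ CAP+tail;
G-an2-4 gates asym, D1 and NE2/3/4.»  [folklore] bookkeeping over the tree's own definitions: exponent arithmetic on an2's change of
units `HessKerDressedUnits.unitS` and an1's field–multiplier stencil `AveragingHessianKernels.vhS`; no estimate, no cited fact, no `def`,
no `Prop` mirror.  NOTHING of the wall is discharged here: the stencil binders `(hS, hSall)` of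
`HessKerDressedUnitsWall.d1Drift_JsBalOf_iff_of_cauchy_unit` concern the WHOLE family `(JsBal0Of … j).S` (`= BalabanStepJetsSucc.Sstep … j`
for `j ≥ 1`), of which the expression treated below is ONE of three summands; the other two (the value-function third jet `e3Of` and the
Lagrange piece `SLam … (lamCoeffK (KInvStep Lc j) (E2 j) Lc) …`) are untouched (S-SLOT.md §2 (P-E‴), (P-Λ)).  0 wall binders instantiated.
NOT summit progress.

## What is proved (generic `d`, blocking factor `Lc` with `NeZero Lc`; units `sfStep Lc j = Lc^j`, `smStep d Lc j = Lc^{j(d+1)}` BY NAME)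
The (V-H) summand of an2's step-`j` stencil `Sstep d Lc cE cVH cΛ j` is `fun κ u ↦ (cVH * wVH d Lc j) • mfNeg (vhS d Lc κ u)` with the
weight `wVH d Lc j = (Lc^j)^{2(d+2)}` (an2/an4, `BalabanStepJetsSucc` v1.2, «PROVISIONAL … certified only by the future proof of (R1)»).
* `unitS_smul_offDiag` — for ANY stencil family `S` supported on the field–multiplier blocks (vanishing `(inl,inl)` and `(inr,inr)`
  blocks) and any weight `w`, `unitS sf sm (w • S) = ((sf·sm)⁻¹·(sf⁻¹·sm⁻¹)·w) • S` — the change of units is a SCALAR on such families.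
* `vh_unit_factor` — the scalar is `1` for `(sf, sm, w) = (sfStep Lc j, smStep d Lc j, wVH d Lc j)`:
  `Lc^{−j}·Lc^{−j(d+1)}·Lc^{−j}·Lc^{−j(d+1)}·Lc^{2j(d+2)} = 1` — the KERNEL CHECK of the numeral `wVH` against the K-slot's units
  (S-SLOT.md (U-S1)): the exponent `2(d+2)` is exactly the one for which the (V-H) piece is unit-consistent with `(sfStep, smStep)`.
* **`unitS_vhPiece_eq`** — `unitS (sfStep Lc j) (smStep d Lc j) (fun κ u ↦ (cVH * wVH d Lc j) • mfNeg (vhS d Lc κ u)) = fun κ u ↦ cVH • mfNeg (vhS d Lc κ u)`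
  for EVERY `j`: after normalisation the (V-H) piece is literally the `j = 0` object.
* **`locStencil_unitS_vhPiece`** — hence, for every `δ ≥ 0` and every `j`, `LocStencil (unitS … (vh piece at j)) (|cVH|·3ℓ²e^{4(d+1)Lc δ}) δ`
  with an1's `j`-FREE constant (`locStencil_vhS`, `ℓ = ell (d+1) Lc`) — the `hS`-shape for this summand, uniformly in `j`;
* **`unitS_vhPiece_sub_eq_zero`** / **`locStencil_unitS_vhPiece_sub`** — and the difference between ANY two levels `k+j`, `k` is the ZERO
  family, so the `hSall`-shape holds for this summand with drift constant `cS = 0` (any `θ`): `LocStencil (… (k+j) − … k) (0·θ^k) δ`.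
So, of the three summands of the S-slot, the (V-H) one costs nothing beyond bookkeeping; see S-SLOT.md for the status of the other two
((P-Λ): K-slot currencies + `decays_comp`; (P-E‴): located, fine-level minimiser bounds — NOT covered by road P1 as landed).
-/

noncomputable section

open Literature.MathematicalPhysics.QuantumFieldTheory
open Literature.MathematicalPhysics.QuantumFieldTheory.Balaban1983to89
open Literature.MathematicalPhysics.QuantumFieldTheory.Balaban1983to89.Beta
open ExpKernelCalculus (MKer BiLoc)
open OneStepResolventKernel (Fib LocStencil)
open StepJetData (mfNeg locStencil_mfNeg)
open AveragingHessianKernels (vhS ell locStencil_vhS)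
open BalabanStepJetsSucc (wVH)
open Summit.QuantumFields.BalabanUV.Beta.HessKerDressedUnits (unitS legScale unitS_apply legScale_inl legScale_inr)
open Summit.QuantumFields.BalabanUV.Beta.GAN24.CombesThomas (sfStep smStep)

namespace Summit.QuantumFields.BalabanUV.Beta.GAN24.StencilSlotVH

variable {d : ℕ}

/-! ## §1 The change of units is a scalar on field–multiplier-supported stencil families -/

/-- [folklore] On a stencil family supported on the two field–multiplier blocks, `unitS sf sm (w • S)` is the scalar multiple
`((sf·sm)⁻¹·(sf⁻¹·sm⁻¹)·w) • S`. -/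
theorem unitS_smul_offDiag (sf sm w : ℝ) (S : Fin (d + 1) → (Fin (d + 1) → ℤ) → MKer (d + 1) (Fib d))
    (hff : ∀ κ u x y (α β : Fin (d + 1)), S κ u x y (Sum.inl α) (Sum.inl β) = 0)
    (hmm : ∀ κ u x y (μ ν : Fin (d + 1)), S κ u x y (Sum.inr μ) (Sum.inr ν) = 0) :
    unitS sf sm (fun κ u => w • S κ u) = fun κ u => ((sf * sm)⁻¹ * (sf⁻¹ * sm⁻¹) * w) • S κ u := by
  funext κ u x y a b
  simp only [unitS_apply, Pi.smul_apply, smul_eq_mul]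
  rcases a with α | μ <;> rcases b with β | ν
  · rw [hff]; ring
  · rw [legScale_inl, legScale_inr]; ring
  · rw [legScale_inr, legScale_inl]; ring
  · rw [hmm]; ring

/-- [folklore] `mfNeg (vhS …)` vanishes on the field–field block (an1's packer `packVH` does). -/
theorem mfNeg_vhS_inl_inl (L : ℕ) (κ : Fin (d + 1)) (u x y : Fin (d + 1) → ℤ) (α β : Fin (d + 1)) :
    mfNeg (vhS d L κ u) x y (Sum.inl α) (Sum.inl β) = 0 := rfl

/-- [folklore] `mfNeg (vhS …)` vanishes on the multiplier–multiplier block. -/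
theorem mfNeg_vhS_inr_inr (L : ℕ) (κ : Fin (d + 1)) (u x y : Fin (d + 1) → ℤ) (μ ν : Fin (d + 1)) :
    mfNeg (vhS d L κ u) x y (Sum.inr μ) (Sum.inr ν) = 0 := rfl

/-! ## §2 The exponent check (U-S1): the weight `wVH j = (Lc^j)^{2(d+2)}` against the units `(Lc^j, Lc^{j(d+1)})` -/

section Units

variable {Lc : ℕ} [NeZero Lc]

/-- [folklore] **(U-S1)** `(s_f s_m)⁻¹ · (s_f⁻¹ s_m⁻¹) · wVH = 1` at `(s_f, s_m) = (Lc^j, Lc^{j(d+1)})`: the exponent count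
`−j − j(d+1) − j − j(d+1) + 2j(d+2) = 0`. -/
theorem vh_unit_factor (j : ℕ) :
    (sfStep Lc j * smStep d Lc j)⁻¹ * ((sfStep Lc j)⁻¹ * (smStep d Lc j)⁻¹) * wVH d Lc j = 1 := by
  have hL : (Lc : ℝ) ≠ 0 := Nat.cast_ne_zero.2 (NeZero.ne Lc)
  have h1 : sfStep Lc j * smStep d Lc j * (sfStep Lc j * smStep d Lc j) = wVH d Lc j := by
    simp only [sfStep, smStep, wVH, ← pow_add, ← pow_mul]
    ring_nf
  have hne : sfStep Lc j * smStep d Lc j ≠ 0 := by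
    simp only [sfStep, smStep]
    exact mul_ne_zero (pow_ne_zero _ hL) (pow_ne_zero _ hL)
  rw [← h1]
  have h2 : (sfStep Lc j * smStep d Lc j)⁻¹ * (sfStep Lc j * smStep d Lc j) = 1 := inv_mul_cancel₀ hne
  calc (sfStep Lc j * smStep d Lc j)⁻¹ * ((sfStep Lc j)⁻¹ * (smStep d Lc j)⁻¹) *
        (sfStep Lc j * smStep d Lc j * (sfStep Lc j * smStep d Lc j))
      = ((sfStep Lc j * smStep d Lc j)⁻¹ * (sfStep Lc j * smStep d Lc j)) *
          ((sfStep Lc j * smStep d Lc j)⁻¹ * (sfStep Lc j * smStep d Lc j)) := by rw [mul_inv]; ring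
    _ = 1 := by rw [h2, one_mul]

/-- [folklore] **THE (V-H) PIECE IS `j`-INDEPENDENT AFTER NORMALISATION**: in the K-slot's units the weighted (V-H) summand of
`Sstep … j` equals an1's bare `cVH • mfNeg (vhS d Lc κ u)` for every `j`. -/
theorem unitS_vhPiece_eq (cVH : ℝ) (j : ℕ) :
    unitS (sfStep Lc j) (smStep d Lc j) (fun κ u => (cVH * wVH d Lc j) • mfNeg (vhS d Lc κ u))
      = fun κ u => cVH • mfNeg (vhS d Lc κ u) := by
  rw [unitS_smul_offDiag _ _ _ (fun κ u => mfNeg (vhS d Lc κ u)) (fun κ u x y α β => mfNeg_vhS_inl_inl Lc κ u x y α β)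
    (fun κ u x y μ ν => mfNeg_vhS_inr_inr Lc κ u x y μ ν)]
  have h : (sfStep Lc j * smStep d Lc j)⁻¹ * ((sfStep Lc j)⁻¹ * (smStep d Lc j)⁻¹) * (cVH * wVH d Lc j) = cVH := by
    calc (sfStep Lc j * smStep d Lc j)⁻¹ * ((sfStep Lc j)⁻¹ * (smStep d Lc j)⁻¹) * (cVH * wVH d Lc j)
        = cVH * ((sfStep Lc j * smStep d Lc j)⁻¹ * ((sfStep Lc j)⁻¹ * (smStep d Lc j)⁻¹) * wVH d Lc j) := by ring
      _ = cVH := by rw [vh_unit_factor, mul_one]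
  rw [h]

/-- [folklore] **`hS`-SHAPE FOR THE (V-H) SUMMAND, UNIFORMLY IN `j`**: for every `δ ≥ 0` and every `j` the normalised piece is a local
stencil family with an1's `j`-free constant `|cVH| · 3ℓ² e^{4(d+1)Lc δ}`, `ℓ = ell (d+1) Lc`. -/
theorem locStencil_unitS_vhPiece (hLc : 1 ≤ Lc) (cVH : ℝ) {δ : ℝ} (hδ : 0 ≤ δ) (j : ℕ) :
    LocStencil (unitS (sfStep Lc j) (smStep d Lc j) (fun κ u => (cVH * wVH d Lc j) • mfNeg (vhS d Lc κ u)))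
      (|cVH| * (3 * (ell (d + 1) Lc : ℝ) ^ 2 * Real.exp (4 * ((d : ℝ) + 1) * Lc * δ))) δ := by
  rw [unitS_vhPiece_eq]
  exact StepJetData.locStencil_smul cVH (locStencil_mfNeg (locStencil_vhS hLc hδ))

/-- [folklore] **ZERO DRIFT**: the normalised (V-H) summands of any two levels `k + j` and `k` coincide — their difference is the zero family. -/
theorem unitS_vhPiece_sub_eq_zero (cVH : ℝ) (k j : ℕ) :
    (fun κ u => unitS (sfStep Lc (k + j)) (smStep d Lc (k + j)) (fun κ u => (cVH * wVH d Lc (k + j)) • mfNeg (vhS d Lc κ u)) κ u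
        - unitS (sfStep Lc k) (smStep d Lc k) (fun κ u => (cVH * wVH d Lc k) • mfNeg (vhS d Lc κ u)) κ u)
      = fun _ _ => 0 := by
  rw [unitS_vhPiece_eq, unitS_vhPiece_eq]
  funext κ u
  exact sub_self _

/-- [folklore] **`hSall`-SHAPE FOR THE (V-H) SUMMAND WITH DRIFT CONSTANT `0`**: for every `θ`, `δ`, `k`, `j`,
`LocStencil (normalised piece at k+j − normalised piece at k) (0 · θ^k) δ`. -/
theorem locStencil_unitS_vhPiece_sub (cVH θ δ : ℝ) (k j : ℕ) :
    LocStencil (fun κ u => unitS (sfStep Lc (k + j)) (smStep d Lc (k + j)) (fun κ u => (cVH * wVH d Lc (k + j)) • mfNeg (vhS d Lc κ u)) κ u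
        - unitS (sfStep Lc k) (smStep d Lc k) (fun κ u => (cVH * wVH d Lc k) • mfNeg (vhS d Lc κ u)) κ u) (0 * θ ^ k) δ := by
  rw [unitS_vhPiece_sub_eq_zero]
  intro κ u x y a b
  simp only [Pi.zero_apply, abs_zero, zero_mul]
  exact le_refl _

end Units

end Summit.QuantumFields.BalabanUV.Beta.GAN24.StencilSlotVH

end
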